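import Summits.BirchSwinnertonDyer.BirchSwinnertonDyer.Theses.KolyvaginRoadThree
import Summits.BirchSwinnertonDyer.BirchSwinnertonDyer.Theorems.ClassRecordThreeValueContinuityAtThreeOfLZZ
import HarnessLib

/-!
# Crux `ValueContinuityAtThree` (VC₃, stmt-BirchSwinnertonDyer-19493) on route `KolyvaginRoadThree` BY NAME modulo ONE refereed
# Literature fact — line `lzz`, the Kolyvagin-road copy

Cell `bsd-stepL` (run/shared/lean/pub/bsd-stepL/), seat `bsd-stepL-thmc-p1x` (WIDTH-LEVER second prover lane on crux 19493, g0,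
2026-08-27), `--supports stmt-BirchSwinnertonDyer-19493 --as helper`. Item 19493 is SHARED by the routes `ClassRecordThree` (child of
`HalvesAtThree` 19107) and `KolyvaginRoadThree` (child of `HalvesTamAtThree` 19155); the two route files render it as ONE statement
(`kolyvaginRoadThree_valueContinuityAtThree_iff_classRecordThree`, p436261, `Iff.rfl`). This file is the one-line transport of
`valueContinuityAtThree_of_thm151_thm153` (`Theorems/ClassRecordThreeValueContinuityAtThreeOfLZZ.lean`, line `lzz` part 3) to the
Kolyvagin road's decl, kept separate so that part 3's import closure stays small.

HONEST FRAMING: ONE THEOREM (0 sorry, 0 def); nothing booked; O2 ∕ B10 stay as labelled; no node, label or census count moves (T7);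
BSD(E,3) is proved for no class. CONDITIONAL (`conditional-result`) on the ONE refereed named fact
`LiuZhangZhang2018.thm151_thm153_modularCurve_heegnerVector` (Duke Math. J. 167 (2018) Thm 1.5.1 ∧ Rem 1.1.2 ∧ Thm 1.5.3; typed p509230).

References: [LiuZhangZhang2018] Duke Math. J. 167 (2018) pp. 745–749; pub/bsd-stepL RULING 17 (C); pub/bsd-eis cgshw MEMO-19 §8.
-/

set_option autoImplicit false
-- the Theorems namespace `Summit.BirchSwinnertonDyer.BirchSwinnertonDyer.Theorems` repeats the summit name by design (D-0017)
set_option linter.dupNamespace false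

noncomputable section

namespace Summit.BirchSwinnertonDyer.BirchSwinnertonDyer.Theorems

/-- **Crux `KolyvaginRoadThree.ValueContinuityAtThree` (stmt-BirchSwinnertonDyer-19493, Kolyvagin-road copy) from the ONE refereed
fact `LiuZhangZhang2018.thm151_thm153_modularCurve_heegnerVector`** — the two routes' decls are definitionally the same statement,
so this is `valueContinuityAtThree_of_thm151_thm153` read at the other name. CONDITIONAL on the named fact `hF`; nothing booked; no
label or count moves. [cite: LiuZhangZhang2018, Thm. 1.5.1 and Remark 1.1.2 and Thm. 1.5.3 (Duke Math. J. 167 (2018) pp. 745–749)] -/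
theorem kolyvaginRoadThree_valueContinuityAtThree_of_thm151_thm153
    (hF : Literature.NumberTheory.EllipticCurves.LiuZhangZhang2018.thm151_thm153_modularCurve_heegnerVector) :
    Theses.KolyvaginRoadThree.ValueContinuityAtThree := by
  unfold Theses.KolyvaginRoadThree.ValueContinuityAtThree
  exact valueContinuityAtThree_of_thm151_thm153 hF

end Summit.BirchSwinnertonDyer.BirchSwinnertonDyer.Theorems

end
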